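import Summits.FinalStateConjecture.FinalStateConjecture.Theses.StarvedNecks
import Summits.FinalStateConjecture.FinalStateConjecture.Theses.GlobalAttraction
import HarnessLib

/-!
# Skeleton — crux stmt-FinalStateConjecture-17575 `Theses.StarvedNecks.HonestFixedRadiusSettlingT` (= T),
# ALTERNATIVE line `far_label_cut` (crux-strategist s3, 2026-08-17) — "censorship | attraction | far gain | LABELS | red-shift"

The live line `Sketch` (lead c7) works ONE dynamical stub `stub_coreKick` which is, kernel-checked
(`Theorems.StarvedNecks.CoreReduction.T_iff_coreKick`, p138197), the whole rays-less crux.  The strategist-s2 line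
`censor_attract_upgrade` (not registered; bridge landed as `Theorems.StarvedNecks.CensorBridge`, p167138) cut it into
censorship | attraction (item 17684) | `C⁰ → C⁴` upgrade, but read the THIRD LAW on honest fixed-radius `C⁰` configurations —
the lead's objection (i): a `C⁰`-close chart pins no curvature, so "every honest `C⁰` configuration has sub-extremal labels" leans
on Lorentzian `C⁰` label rigidity, a frontier question — and its five-piece cut exceeds a strategist split.

THIS line moves the ONE place where hole labels are read to the FAR ANNULI at `C³`:

  `Fc(d, R₀)` := for every hole `i` and radius `R`, the `C³` sup-deviation of `(chart i)^* g` from boosted Kerr `(Mᵢ, aᵢ, Λᵢ, cᵢ)`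
  on the far annulus `{t*ᵢ = τ, R₀ ≤ rᵢ ≤ R}` tends to `0` as `τ → ∞`    (`R₀ ≥ 100 Mᵢ`: far from horizon, ergoregion, photon sphere).

On such an annulus the Weyl invariants `I₁, I₂` and the gradient invariants `I₅, I₆, I₇` of the physical metric converge pointwise
to their Kerr values, and Abdelqader–Lake (PRD 91 (2015) 084017 = arXiv:1412.8757, §4 "local approach") express `m` and `a/m`
as explicit POINTWISE functions of exactly these invariants: the labels `(Mᵢ, aᵢ)` of an honest far-`C³` configuration are
scalars of the spacetime, not of the chart — no near-isometry compactness, no `C⁰` rigidity.  Far-`C³` is also label-FREE to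
produce: Aretakis growth is horizon-localised, so the derivative gain on `{rᵢ ≥ 100 Mᵢ}` needs no sub-extremality; and for
far-clean data (`h = (1+2M/r)δ + o₆(r⁻¹)`, `k = o₅(r⁻²)`) fixed-radius derivatives of the focused far field decay
(Disproof §6), which is what the `wDist`-dense far-rough trains of Disproof §5(a)/L1 deny in general.

Stubs (4; the crux BY NAME is `HonestFixedRadiusSettlingT_of`):
* `stub_genericCensoredLabelsFar` (GENERIC, chart-free; ⊇ item 17269 tame WCC; nearest items 17297
  `GlobalAttraction.GenericCensorshipThirdLaw` and s2's `Sub₁`): tame-generically the datum is far-clean, has an MGHD, every MGHD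
  has complete `𝓘⁺`, every honest far-`C³` configuration has sub-extremal labels (third law, read where labels are curvature
  scalars), every honest `C⁴` configuration has pairwise distinct four-velocities (recession, T's own format, s2's clause verbatim);
* `stub_censoredFixedRadiusSettle` = item stmt-FinalStateConjecture-17684 BY NAME (Komech-type attraction, `C⁰`, deterministic);
* `stub_farDerivativeGain` (DETERMINISTIC, label-free, new): far-clean datum + honest `C⁰` configuration of a censored MGHD ⟹ an
  honest `C⁰` configuration that is moreover far-`C³` (`Fc`), rays clause re-delivered;
* `stub_subextremalRedShiftUpgrade` (DETERMINISTIC, new): far-clean datum + honest far-`C³` configuration with SUB-EXTREMAL labels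
  ⟹ an honest fixed-radius `C⁴` configuration (T's `Hc ∧ Hf`), rays clause re-delivered (red-shift; Hintz arXiv:2606.28253 for the
  near-Kerr end-game in the full sub-extremal range).
Kernel-checked seams (sorry-free): `honestLabelledUpgrade_of_gain_redshift : Gain → RedShift → HonestLabelledUpgrade` (the
label hypothesis is consumed exactly once, between the two upgrades) and `HonestFixedRadiusSettlingT_of_subs :
GenericCensoredLabelsFar → CensoredFixedRadiusSettle → HonestLabelledUpgrade → T` — the three-piece ROUTE SPLIT this line backs
(Theses-free twin: `Theorems/StarvedNecksHonestFixedRadiusSettlingTFarLabelSplit.lean`).  No S (17574) / E / F / 17673 tail: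
the rays clause travels with the configurations.

Disproof used (Cruxes/HonestFixedRadiusSettlingT/Disproof.lean v4): `settlesHonestlyT_false_without_isMaximal` — every stub keeps
the guard `𝒟.IsMaximal →`; §5(a)/L1 (`k = 4` fails `wDist`-densely at far-rough data) — far-cleanliness sits INSIDE the generic
property and is a HYPOTHESIS of both deterministic stubs; §2 `T_false_of_not_tameWCC` — the generic stub contains tame WCC openly
(`CensorBridge.wccTame_of_censorship` pattern); §3/§4 flat-class census (`Negative/FlatClassCensusT`, `Negative/KillShapeT`) concern
`P_T` at the trivial datum, where every stub holds or is vacuous (`N = 0`).  STUCK GOAL DODGED: the lead's `stub_coreKick` asks for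
censorship + settling + labels + `C⁴` along ONE tame curve at once; here the only generic statement asserts no chart, and the label
reading needs no rigidity theorem.
-/


set_option linter.dupNamespace false

noncomputable section

open scoped Manifold ContDiff ENNReal Topology
open Filter Set Function Literature.Geometry.Lorentzian

namespace Summit.FinalStateConjecture.FinalStateConjecture.Cruxes.HonestFixedRadiusSettlingT.FarLabelCut

/-- **stub_genericCensoredLabelsFar** (THE GENERIC STUB — censorship, far-`C³` third law, `C⁴` recession, far-cleanliness; NO
chart-existence claim).  For every admissible `3`-manifold `X`, TAME-Christodoulou-generically in `admissibleVacuumData X`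
(codimension `1`): the datum is far-clean to order `(6,5)` on some end, it has an MGHD, and EVERY MGHD `𝒟` has complete `𝓘⁺`
(sojourn form) AND (third law, read at far-`C³`) every honest fixed-radius `C⁰` configuration `(O, d : FinalStateDecomposition … O 0, R₀)`
with `O = exteriorOf 𝒟 d.charted`, `RaysStayInClosure 𝒟 O`, `Hc0(d, R₀)` (T's HonestCore without sub-extremality), `Hf(d, R₀)`
(T's HonestFar) and `Fc(d, R₀)` (`C³` convergence on every far annulus `{t*ᵢ = τ, R₀ ≤ rᵢ ≤ R}`) has ONLY sub-extremal labels
`|aᵢ| < Mᵢ`, AND (recession, read at `C⁴`, T's own format, verbatim the strategist-s2 clause) every honest fixed-radius `C⁴`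
configuration has pairwise DISTINCT asymptotic four-velocities.  Why plausibly true: weak cosmic censorship (Christodoulou CQG 16
(1999) A23); the third law as a THRESHOLD statement — extremal horizons form only on positive-codimension data (Kehle–Unger
arXiv:2402.10190, extremal formation as a critical phenomenon; their §6 counterexamples to the naive third law are codimension ≥ 1);
on a far-`C³` annulus the labels are pointwise curvature scalars of the spacetime (Abdelqader–Lake arXiv:1412.8757 §4: `m`, `a/m`
from `I₁, I₂, I₅, I₆, I₇`), so no spurious labelling survives; comoving final pairs are a threshold phenomenon (cards
late-pair-kick / repulsive-quadratic-kicks, `ComovingPairWitness` p73407); far-cleaning along tame curves = broom + kick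
(Disproof §5(a), `not_isImmersedAtZero_of_eventuallyEq`).  Contains item 17269 (tame WCC).  OPEN PROBLEM (censorship).  Size XL.
Why it might fail: censorship itself; a tame-STABLE (codimension-0) family forming an extremal remnant or a parabolic pair; an
honest far-`C³` annulus of a NON-settling censored MGHD whose pointwise Kerr scalars converge to an extremal pair; cleaning that
cannot preserve censorship at a rough censored datum.  Leans on: `InitialDataSet.IsTameChristodoulouGeneric`, `admissibleVacuumData`,
`AFEnd.IsStronglyAsymptoticallyFlatWith`, `HasCompleteNullInfinity`, `exteriorOf`, `RaysStayInClosure`, `Kerr.IsSubextremal`,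
`supCkENorm`, `Spacetime.deviationExtend` (all in tree). -/
theorem stub_genericCensoredLabelsFar : open Literature.Geometry.Lorentzian in open scoped ContDiff ENNReal in let Hc0 := (fun (𝓢 : Spacetime.{0} 4) (O : Set 𝓢.carrier) (k : ℕ) (d : FinalStateDecomposition 𝓢 O k) (R₀ : ℝ) => let B := d.background; let t := fun i ↦ (B i).time; let r := fun i ↦ (B i).radius; let Ψ := d.chart; (∀ i, 100 * d.mass i ≤ R₀ ∧ 0 < ((d.motion i).1 : E4 ≃L[ℝ] E4) (E4.basisVector 0) 0) ∧ (∀ i (ϱ τ₂ : ℝ), R₀ ≤ ϱ → d.τ₀ < τ₂ → Ψ i '' {x | d.τ₀ < t i x.1 ∧ t i x.1 < τ₂ ∧ r i x.1 < ϱ} ⊆ 𝓢.metric.causalPast 𝓢.timeOrientation (Ψ i '' (B i).truncTimeSlab ϱ τ₂)) ∧ (∀ i (τ' : ℝ) (ϱ : ℝ → ℝ), Continuous ϱ → d.τ₀ < τ' → let A := Ψ i '' {x | τ' ≤ t i x.1 ∧ r i x.1 ≤ ϱ (t i x.1)}; closure A ∩ O ⊆ A) ∧ (∀ y : d.flatDomain,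 d.τ₀ < y.1 0 → 𝓢.timeOrientation.IsFutureDirected (mfderiv 𝓘(ℝ, E4) (𝓡 4) d.flatChart y (E4.basisVector 0)))); let Hc := ( fun (𝓢 : Spacetime.{0} 4) (O : Set 𝓢.carrier) (k : ℕ) (d : FinalStateDecomposition 𝓢 O k) (R₀ : ℝ) => let B := d.background; let t := fun i ↦ (B i).time; let r := fun i ↦ (B i).radius; let Ψ := d.chart; (∀ i, Kerr.IsSubextremal (d.mass i) (d.spin i) ∧ 100 * d.mass i ≤ R₀ ∧ 0 < ((d.motion i).1 : E4 ≃L[ℝ] E4) (E4.basisVector 0) 0) ∧ (∀ i (ϱ τ₂ : ℝ), R₀ ≤ ϱ → d.τ₀ < τ₂ → Ψ i '' {x | d.τ₀ < t i x.1 ∧ t i x.1 < τ₂ ∧ r i x.1 < ϱ} ⊆ 𝓢.metric.causalPast 𝓢.timeOrientation (Ψ i '' (B i).truncTimeSlab ϱ τ₂)) ∧ (∀ i (τ' : ℝ) (ϱ : ℝ → ℝ), Continuous ϱ → d.τ₀ < τ' → let A := Ψ i '' {x | τ' ≤ t i x.1 ∧ r i x.1 ≤ ϱ (t i x.1)}; closure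 A ∩ O ⊆ A) ∧ (∀ y : d.flatDomain, d.τ₀ < y.1 0 → 𝓢.timeOrientation.IsFutureDirected (mfderiv 𝓘(ℝ, E4) (𝓡 4) d.flatChart y (E4.basisVector 0))) ); let Hf := ( fun (𝓢 : Spacetime.{0} 4) (O : Set 𝓢.carrier) (k : ℕ) (d : FinalStateDecomposition 𝓢 O k) (R₀ : ℝ) => let B := d.background; let t := fun i ↦ (B i).time; let r := fun i ↦ (B i).radius; let Φ := d.flatChart; (∀ τ₂ : ℝ, d.τ₀ < τ₂ → Φ '' {y | d.τ₀ < y.1 0 ∧ y.1 0 < τ₂} ⊆ 𝓢.metric.causalPast 𝓢.timeOrientation (Φ '' (Minkowski.backgroundOn d.flatDomain).timeSlab τ₂)) ∧ (∀ τ' : ℝ, d.τ₀ < τ' → closure (Φ '' {y | τ' ≤ y.1 0 ∧ ∀ i, d.excision i (y.1 0) + 1 ≤ r i y.1}) ⊆ Φ '' {y | τ' ≤ y.1 0}) ∧ (∀ i, ∃ T : ℝ, supCkENorm (Subtype.val '' {x : (B i).domain | T ≤ t i x.1 ∧ R₀ ≤ r i x.1 ∧ ∀ j, j ≠ i → r i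 x.1 ≤ r j x.1}) 0 (𝓢.deviationExtend (B i) (d.chart i)) ≤ ENNReal.ofReal (1 / (10 * ‖(((d.motion i).1 : E4 ≃L[ℝ] E4) : E4 →L[ℝ] E4)‖ ^ 2))) ); let Fc := (fun (𝓢 : Spacetime.{0} 4) (O : Set 𝓢.carrier) (k : ℕ) (d : FinalStateDecomposition 𝓢 O k) (R₀ : ℝ) => let B := d.background; let t := fun i ↦ (B i).time; let r := fun i ↦ (B i).radius; (∀ i (R : ℝ), Filter.Tendsto (fun τ : ℝ ↦ supCkENorm (Subtype.val '' {x : (B i).domain | t i x.1 = τ ∧ R₀ ≤ r i x.1 ∧ r i x.1 ≤ R}) 3 (𝓢.deviationExtend (B i) (d.chart i))) Filter.atTop (nhds 0))); ∀ (X : Type) [TopologicalSpace X] [ChartedSpace E3 X] [IsManifold (𝓡 3) ∞ X] [T2Space X] [SecondCountableTopology X] [ConnectedSpace X], InitialDataSet.IsTameChristodoulouGeneric (admissibleVacuumData X) (fun D ↦ (∃ (e : AFEnd X) (M : ℝ), e.IsStronglyAsymptoticallyFlatWith D M 1 2 6 5) ∧ (∃ 𝒟 : VacuumCauchyDevelopment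 D, 𝒟.IsMaximal) ∧ ∀ 𝒟 : VacuumCauchyDevelopment D, 𝒟.IsMaximal → HasCompleteNullInfinity 𝒟.toCauchyDevelopment ∧ (∀ (O : Set 𝒟.carrier) (d : FinalStateDecomposition 𝒟.toSpacetime O 0) (R₀ : ℝ), O = exteriorOf 𝒟.toCauchyDevelopment d.charted → RaysStayInClosure 𝒟.toCauchyDevelopment O → Hc0 𝒟.toSpacetime O 0 d R₀ → Hf 𝒟.toSpacetime O 0 d R₀ → Fc 𝒟.toSpacetime O 0 d R₀ → ∀ i, Kerr.IsSubextremal (d.mass i) (d.spin i)) ∧ (∀ (O : Set 𝒟.carrier) (d : FinalStateDecomposition 𝒟.toSpacetime O 4) (R₀ : ℝ), O = exteriorOf 𝒟.toCauchyDevelopment d.charted → Hc 𝒟.toSpacetime O 4 d R₀ → Hf 𝒟.toSpacetime O 4 d R₀ → (∀ i j : Fin d.N, i ≠ j → ((d.motion i).1 : E4 ≃L[ℝ] E4) (E4.basisVector 0) ≠ ((d.motion j).1 : E4 ≃L[ℝ] E4) (E4.basisVector 0)))) 1 := by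
  sorry

/-- **stub_censoredFixedRadiusSettle** — DELEGATED, BY NAME: item stmt-FinalStateConjecture-17684
`Theses.GlobalAttraction.CensoredFixedRadiusSettle` (route GlobalAttraction, crux; child X₁ of the strategist split of
`CensoredExteriorsSettle` 17296, registered skeleton `Cruxes/CensoredExteriorsSettle/Lines/neck_split.lean`): KOMECH-TYPE ATTRACTION,
deterministic, all censored data, `C⁰`, `|aᵢ| ≤ Mᵢ` — every MGHD with complete `𝓘⁺` of an admissible datum carries
`(O, d : FinalStateDecomposition … O 0, R₀)` with `O = exteriorOf`, `RaysStayInClosure`, `IsFutureOriented d`, `Hc0 ∧ Hf`.  Never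
worked inside this line (second child of the route split verbatim, deduplicated onto 17684). -/
theorem stub_censoredFixedRadiusSettle : Theses.GlobalAttraction.CensoredFixedRadiusSettle := by
  sorry

/-- **stub_farDerivativeGain** (DETERMINISTIC, LABEL-FREE, new).  For every admissible datum `D` that is far-clean to order `(6,5)`
on some end, every MGHD `𝒟` with complete `𝓘⁺`, and every honest fixed-radius `C⁰` configuration `(O₀, d₀, R₀)` of `𝒟`
(`O₀ = exteriorOf 𝒟 d₀.charted`, `RaysStayInClosure`, `IsFutureOriented d₀`, `Hc0`, `Hf`), there is an honest fixed-radius `C⁰`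
configuration `(O, d : FinalStateDecomposition … O 0, R₁)` — `O = exteriorOf 𝒟 d.charted`, `RaysStayInClosure 𝒟 O`, `Hc0(d, R₁)`,
`Hf(d, R₁)` — which is moreover FAR-`C³`: `Fc(d, R₁)`, the `C³` sup-deviation from boosted Kerr on every far annulus
`{t*ᵢ = τ, R₁ ≤ rᵢ ≤ R}` tends to `0`.  Pure derivative gain AWAY from the holes (`R₁ ≥ 100 Mᵢ`: outside horizon, ergoregion and
photon sphere), so NO label hypothesis: Aretakis growth of transversal derivatives is horizon-localised and decay holds away from
the horizon even at extremality (Aretakis arXiv:1110.2007, arXiv:1206.6598).  Intended proof: re-gauge each hole chart on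
`{rᵢ ≥ R₁}` (keeping it near the horizon, where only `C⁰` is claimed) to a wave/harmonic-type gauge in which the vacuum equations are
quasi-diagonal hyperbolic; `C⁰`-settling + far-cleanliness bound the energy flux through the far annuli at late times, and
interior hyperbolic/elliptic regularity on the compact annulus slabs converts flux decay into `C³` decay of the deviation (for
far-clean data fixed-radius `m`-th derivatives of the focused far field are `o(t^{-m})`, `m ≤ 6`, Disproof §6); the honesty clauses
(anchoring, relative closedness, Voronoi `C⁰` honesty F3) and the rays clause survive because `O` may be re-chosen
(`∃ O`).  Nearest item: 17298 `GlobalAttraction.SubextremalUpgrade` (`C⁰ → C²`, exhaustive format, label-dependent).  Size L–XL.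
Why it might fail: `C⁰` closeness in SOME chart gives no derivative control — small-amplitude HIGH-FREQUENCY content crossing the
far annuli at arbitrarily late times (Burnett-type high-frequency limits, Huneau–Luk arXiv:1907.10743; refocused late-time tails,
Luk–Oh arXiv:2404.02220; slow leakage from stably trapped regions of ANOTHER component) would be `C⁰`- but not `C³`-settled; the
bet is that far-cleanliness + complete `𝓘⁺` + `C⁰` settling of the WHOLE exterior starve such content.  Leans on: `supCkENorm`,
`Spacetime.deviationExtend`, `FinalStateDecomposition`, `exteriorOf`, `RaysStayInClosure`, `IsFutureOriented` (tree). -/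
theorem stub_farDerivativeGain : open Literature.Geometry.Lorentzian in open scoped ContDiff ENNReal in let Hc0 := (fun (𝓢 : Spacetime.{0} 4) (O : Set 𝓢.carrier) (k : ℕ) (d : FinalStateDecomposition 𝓢 O k) (R₀ : ℝ) => let B := d.background; let t := fun i ↦ (B i).time; let r := fun i ↦ (B i).radius; let Ψ := d.chart; (∀ i, 100 * d.mass i ≤ R₀ ∧ 0 < ((d.motion i).1 : E4 ≃L[ℝ] E4) (E4.basisVector 0) 0) ∧ (∀ i (ϱ τ₂ : ℝ), R₀ ≤ ϱ → d.τ₀ < τ₂ → Ψ i '' {x | d.τ₀ < t i x.1 ∧ t i x.1 < τ₂ ∧ r i x.1 < ϱ} ⊆ 𝓢.metric.causalPast 𝓢.timeOrientation (Ψ i '' (B i).truncTimeSlab ϱ τ₂)) ∧ (∀ i (τ' : ℝ) (ϱ : ℝ → ℝ), Continuous ϱ → d.τ₀ < τ' → let A := Ψ i '' {x | τ' ≤ t i x.1 ∧ r i x.1 ≤ ϱ (t i x.1)}; closure A ∩ O ⊆ A) ∧ (∀ y : d.flatDomain, d.τ₀ < y.1 0 → 𝓢.timeOrientation.IsFutureDirected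 (mfderiv 𝓘(ℝ, E4) (𝓡 4) d.flatChart y (E4.basisVector 0)))); let Hf := ( fun (𝓢 : Spacetime.{0} 4) (O : Set 𝓢.carrier) (k : ℕ) (d : FinalStateDecomposition 𝓢 O k) (R₀ : ℝ) => let B := d.background; let t := fun i ↦ (B i).time; let r := fun i ↦ (B i).radius; let Φ := d.flatChart; (∀ τ₂ : ℝ, d.τ₀ < τ₂ → Φ '' {y | d.τ₀ < y.1 0 ∧ y.1 0 < τ₂} ⊆ 𝓢.metric.causalPast 𝓢.timeOrientation (Φ '' (Minkowski.backgroundOn d.flatDomain).timeSlab τ₂)) ∧ (∀ τ' : ℝ, d.τ₀ < τ' → closure (Φ '' {y | τ' ≤ y.1 0 ∧ ∀ i, d.excision i (y.1 0) + 1 ≤ r i y.1}) ⊆ Φ '' {y | τ' ≤ y.1 0}) ∧ (∀ i, ∃ T : ℝ, supCkENorm (Subtype.val '' {x : (B i).domain | T ≤ t i x.1 ∧ R₀ ≤ r i x.1 ∧ ∀ j, j ≠ i → r i x.1 ≤ r j x.1}) 0 (𝓢.deviationExtend (B i) (d.chart i)) ≤ ENNReal.ofReal (1 / (10 * ‖(((d.motion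 i).1 : E4 ≃L[ℝ] E4) : E4 →L[ℝ] E4)‖ ^ 2))) ); let Fc := (fun (𝓢 : Spacetime.{0} 4) (O : Set 𝓢.carrier) (k : ℕ) (d : FinalStateDecomposition 𝓢 O k) (R₀ : ℝ) => let B := d.background; let t := fun i ↦ (B i).time; let r := fun i ↦ (B i).radius; (∀ i (R : ℝ), Filter.Tendsto (fun τ : ℝ ↦ supCkENorm (Subtype.val '' {x : (B i).domain | t i x.1 = τ ∧ R₀ ≤ r i x.1 ∧ r i x.1 ≤ R}) 3 (𝓢.deviationExtend (B i) (d.chart i))) Filter.atTop (nhds 0))); ∀ (X : Type) [TopologicalSpace X] [ChartedSpace E3 X] [IsManifold (𝓡 3) ∞ X] [T2Space X] [SecondCountableTopology X] [ConnectedSpace X], ∀ D ∈ admissibleVacuumData X, (∃ (e : AFEnd X) (M : ℝ), e.IsStronglyAsymptoticallyFlatWith D M 1 2 6 5) → ∀ 𝒟 : VacuumCauchyDevelopment D, 𝒟.IsMaximal → HasCompleteNullInfinity 𝒟.toCauchyDevelopment → ∀ (O₀ : Set 𝒟.carrier) (d₀ : FinalStateDecomposition 𝒟.toSpacetime O₀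 0) (R₀ : ℝ), O₀ = exteriorOf 𝒟.toCauchyDevelopment d₀.charted → RaysStayInClosure 𝒟.toCauchyDevelopment O₀ → IsFutureOriented d₀ → Hc0 𝒟.toSpacetime O₀ 0 d₀ R₀ → Hf 𝒟.toSpacetime O₀ 0 d₀ R₀ → ∃ (O : Set 𝒟.carrier) (d : FinalStateDecomposition 𝒟.toSpacetime O 0) (R₁ : ℝ), O = exteriorOf 𝒟.toCauchyDevelopment d.charted ∧ RaysStayInClosure 𝒟.toCauchyDevelopment O ∧ Hc0 𝒟.toSpacetime O 0 d R₁ ∧ Hf 𝒟.toSpacetime O 0 d R₁ ∧ Fc 𝒟.toSpacetime O 0 d R₁ := by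
  sorry

/-- **stub_subextremalRedShiftUpgrade** (DETERMINISTIC, new; the ONLY consumer of the labels).  For every admissible far-clean
datum `D`, every MGHD `𝒟` with complete `𝓘⁺`, and every honest fixed-radius `C⁰` configuration `(O₁, d₁, R₁)` of `𝒟` that is
far-`C³` (`Fc(d₁, R₁)`) and ALL of whose labels are SUB-extremal `|aᵢ| < Mᵢ`, there is an honest fixed-radius `C⁴` configuration
`(O, d : FinalStateDecomposition … O 4, R₂)`: `O = exteriorOf 𝒟 d.charted`, `RaysStayInClosure 𝒟 O`, `Hc(d, R₂)` (T's HonestCore,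
sub-extremal holes), `Hf(d, R₂)`.  Intended proof: keep holes and labels of `d₁`; the labels being the physical ones (far-`C³`),
each horizon is a sub-extremal Kerr horizon with surface gravity `κᵢ > 0`, and the red-shift vector field (Dafermos–Rodnianski
arXiv:0811.0354 §3–§7; full sub-extremal range arXiv:1402.7034) plus elliptic–hyperbolic regularity on the fixed-radius slabs
upgrade `C⁰`-closeness near the horizon and `C³`-closeness on the far annuli to `C⁴`-closeness on every `{t*ᵢ = τ, rᵢ ≤ R}`; the
near-Kerr end-game in the full sub-extremal range is Hintz arXiv:2606.28253 (settling at rate `t^{-2-ε}` in spatially compact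
regions, with `O(r^{-1-ε})` data — our far-clean class); the flat chart is rebuilt in the same class and far-cleanliness keeps the
incoming far field invisible in unweighted `C⁴` sups at fixed radius (Disproof §6 vs §5(a)).  Cousin of item 17298
`GlobalAttraction.SubextremalUpgrade` and of s2's `stub_honestRegularityUpgrade` (which started from `C⁰` only).  Size XL.
Why it might fail: `C⁰`-closeness near the horizon in SOME chart does not place a late slab in Hintz's weighted Sobolev
neighbourhood — near-horizon high-frequency content (slowly decaying quasinormal ringing is fine; a genuinely non-decaying
near-horizon `C¹` defect would not be) must be excluded from `C⁰` settling + censorship alone; the honesty clauses (anchoring C2,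
relative closedness C3, future-directed flat chart, Voronoi honesty F3) must survive the chart rebuild.  Leans on:
`Kerr.IsSubextremal`, `supCkENorm`, `FinalStateDecomposition`, `exteriorOf`, `RaysStayInClosure` (tree); Literature red-shift
facts are NOT yet formalised (none invoked by name). -/
theorem stub_subextremalRedShiftUpgrade : open Literature.Geometry.Lorentzian in open scoped ContDiff ENNReal in let Hc0 := (fun (𝓢 : Spacetime.{0} 4) (O : Set 𝓢.carrier) (k : ℕ) (d : FinalStateDecomposition 𝓢 O k) (R₀ : ℝ) => let B := d.background; let t := fun i ↦ (B i).time; let r := fun i ↦ (B i).radius; let Ψ := d.chart; (∀ i, 100 * d.mass i ≤ R₀ ∧ 0 < ((d.motion i).1 : E4 ≃L[ℝ] E4) (E4.basisVector 0) 0) ∧ (∀ i (ϱ τ₂ : ℝ), R₀ ≤ ϱ → d.τ₀ < τ₂ → Ψ i '' {x | d.τ₀ < t i x.1 ∧ t i x.1 < τ₂ ∧ r i x.1 < ϱ} ⊆ 𝓢.metric.causalPast 𝓢.timeOrientation (Ψ i '' (B i).truncTimeSlab ϱ τ₂)) ∧ (∀ i (τ' : ℝ) (ϱ : ℝ → ℝ),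 Continuous ϱ → d.τ₀ < τ' → let A := Ψ i '' {x | τ' ≤ t i x.1 ∧ r i x.1 ≤ ϱ (t i x.1)}; closure A ∩ O ⊆ A) ∧ (∀ y : d.flatDomain, d.τ₀ < y.1 0 → 𝓢.timeOrientation.IsFutureDirected (mfderiv 𝓘(ℝ, E4) (𝓡 4) d.flatChart y (E4.basisVector 0)))); let Hc := ( fun (𝓢 : Spacetime.{0} 4) (O : Set 𝓢.carrier) (k : ℕ) (d : FinalStateDecomposition 𝓢 O k) (R₀ : ℝ) => let B := d.background; let t := fun i ↦ (B i).time; let r := fun i ↦ (B i).radius; let Ψ := d.chart; (∀ i, Kerr.IsSubextremal (d.mass i) (d.spin i) ∧ 100 * d.mass i ≤ R₀ ∧ 0 < ((d.motion i).1 : E4 ≃L[ℝ] E4) (E4.basisVector 0) 0) ∧ (∀ i (ϱ τ₂ : ℝ), R₀ ≤ ϱ → d.τ₀ < τ₂ → Ψ i '' {x | d.τ₀ < t i x.1 ∧ t i x.1 < τ₂ ∧ r i x.1 < ϱ} ⊆ 𝓢.metric.causalPast 𝓢.timeOrientation (Ψ i '' (B i).truncTimeSlab ϱ τ₂)) ∧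 (∀ i (τ' : ℝ) (ϱ : ℝ → ℝ), Continuous ϱ → d.τ₀ < τ' → let A := Ψ i '' {x | τ' ≤ t i x.1 ∧ r i x.1 ≤ ϱ (t i x.1)}; closure A ∩ O ⊆ A) ∧ (∀ y : d.flatDomain, d.τ₀ < y.1 0 → 𝓢.timeOrientation.IsFutureDirected (mfderiv 𝓘(ℝ, E4) (𝓡 4) d.flatChart y (E4.basisVector 0))) ); let Hf := ( fun (𝓢 : Spacetime.{0} 4) (O : Set 𝓢.carrier) (k : ℕ) (d : FinalStateDecomposition 𝓢 O k) (R₀ : ℝ) => let B := d.background; let t := fun i ↦ (B i).time; let r := fun i ↦ (B i).radius; let Φ := d.flatChart; (∀ τ₂ : ℝ, d.τ₀ < τ₂ → Φ '' {y | d.τ₀ < y.1 0 ∧ y.1 0 < τ₂} ⊆ 𝓢.metric.causalPast 𝓢.timeOrientation (Φ '' (Minkowski.backgroundOn d.flatDomain).timeSlab τ₂)) ∧ (∀ τ' : ℝ, d.τ₀ < τ' → closure (Φ '' {y | τ' ≤ y.1 0 ∧ ∀ i, d.excision i (y.1 0) + 1 ≤ r i y.1}) ⊆ Φ '' {y | τ'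 ≤ y.1 0}) ∧ (∀ i, ∃ T : ℝ, supCkENorm (Subtype.val '' {x : (B i).domain | T ≤ t i x.1 ∧ R₀ ≤ r i x.1 ∧ ∀ j, j ≠ i → r i x.1 ≤ r j x.1}) 0 (𝓢.deviationExtend (B i) (d.chart i)) ≤ ENNReal.ofReal (1 / (10 * ‖(((d.motion i).1 : E4 ≃L[ℝ] E4) : E4 →L[ℝ] E4)‖ ^ 2))) ); let Fc := (fun (𝓢 : Spacetime.{0} 4) (O : Set 𝓢.carrier) (k : ℕ) (d : FinalStateDecomposition 𝓢 O k) (R₀ : ℝ) => let B := d.background; let t := fun i ↦ (B i).time; let r := fun i ↦ (B i).radius; (∀ i (R : ℝ), Filter.Tendsto (fun τ : ℝ ↦ supCkENorm (Subtype.val '' {x : (B i).domain | t i x.1 = τ ∧ R₀ ≤ r i x.1 ∧ r i x.1 ≤ R}) 3 (𝓢.deviationExtend (B i) (d.chart i))) Filter.atTop (nhds 0))); ∀ (X : Type) [TopologicalSpace X] [ChartedSpace E3 X] [IsManifold (𝓡 3) ∞ X] [T2Space X] [SecondCountableTopology X] [ConnectedSpace X], ∀ D ∈ admissibleVacuumData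 X, (∃ (e : AFEnd X) (M : ℝ), e.IsStronglyAsymptoticallyFlatWith D M 1 2 6 5) → ∀ 𝒟 : VacuumCauchyDevelopment D, 𝒟.IsMaximal → HasCompleteNullInfinity 𝒟.toCauchyDevelopment → ∀ (O₁ : Set 𝒟.carrier) (d₁ : FinalStateDecomposition 𝒟.toSpacetime O₁ 0) (R₁ : ℝ), O₁ = exteriorOf 𝒟.toCauchyDevelopment d₁.charted → RaysStayInClosure 𝒟.toCauchyDevelopment O₁ → Hc0 𝒟.toSpacetime O₁ 0 d₁ R₁ → Hf 𝒟.toSpacetime O₁ 0 d₁ R₁ → Fc 𝒟.toSpacetime O₁ 0 d₁ R₁ → (∀ i, Kerr.IsSubextremal (d₁.mass i) (d₁.spin i)) → ∃ (O : Set 𝒟.carrier) (d : FinalStateDecomposition 𝒟.toSpacetime O 4) (R₂ : ℝ), O = exteriorOf 𝒟.toCauchyDevelopment d.charted ∧ RaysStayInClosure 𝒟.toCauchyDevelopment O ∧ Hc 𝒟.toSpacetime O 4 d R₂ ∧ Hf 𝒟.toSpacetime O 4 d R₂ := by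
  sorry

/-- Tame Christodoulou genericity (codimension `1`) is antitone in the exceptional set (verbatim the `mono` step of the
route's `closes`). [folklore] -/
theorem mono {X : Type} [TopologicalSpace X] [ChartedSpace E3 X] [IsManifold (𝓡 3) ∞ X]
    {𝓓 : Set (InitialDataSet (𝓡 3) X)} {P Q : InitialDataSet (𝓡 3) X → Prop}
    (hPQ : ∀ D ∈ 𝓓, P D → Q D) (hP : InitialDataSet.IsTameChristodoulouGeneric 𝓓 P 1) :
    InitialDataSet.IsTameChristodoulouGeneric 𝓓 Q 1 := by
  intro d hd
  obtain ⟨e, F, hF, himm, h0, hinj, hmem, hE⟩ := hP d ⟨hd.1, fun h ↦ hd.2 (hPQ d hd.1 h)⟩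
  exact ⟨e, F, hF, himm, h0, hinj, hmem, fun c hc hc' ↦ hE c hc ⟨hc'.1, fun h ↦ hc'.2 (hPQ _ hc'.1 h)⟩⟩

/-- **Split child 3 from stubs 3 + 4 (kernel-checked seam).**  The composite deterministic upgrade `HonestLabelledUpgrade`
(honest `C⁰` configuration of a far-clean censored MGHD + the far-`C³` label hypothesis of that development ⟹ honest `C⁴`
configuration with the rays clause) follows from the label-free far gain and the sub-extremal red-shift upgrade: the label
hypothesis is read exactly once, on the far-`C³` configuration the gain produces. -/
theorem honestLabelledUpgrade_of_gain_redshift :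
    (open Literature.Geometry.Lorentzian in open scoped ContDiff ENNReal in let Hc0 := (fun (𝓢 : Spacetime.{0} 4) (O : Set 𝓢.carrier) (k : ℕ) (d : FinalStateDecomposition 𝓢 O k) (R₀ : ℝ) => let B := d.background; let t := fun i ↦ (B i).time; let r := fun i ↦ (B i).radius; let Ψ := d.chart; (∀ i, 100 * d.mass i ≤ R₀ ∧ 0 < ((d.motion i).1 : E4 ≃L[ℝ] E4) (E4.basisVector 0) 0) ∧ (∀ i (ϱ τ₂ : ℝ), R₀ ≤ ϱ → d.τ₀ < τ₂ → Ψ i '' {x | d.τ₀ < t i x.1 ∧ t i x.1 < τ₂ ∧ r i x.1 < ϱ} ⊆ 𝓢.metric.causalPast 𝓢.timeOrientation (Ψ i '' (B i).truncTimeSlab ϱ τ₂)) ∧ (∀ i (τ' : ℝ) (ϱ : ℝ → ℝ), Continuous ϱ → d.τ₀ < τ' → let A := Ψ i '' {x | τ' ≤ t i x.1 ∧ r i x.1 ≤ ϱ (t i x.1)}; closure A ∩ O ⊆ A) ∧ (∀ y : d.flatDomain, d.τ₀ < y.1 0 → 𝓢.timeOrientation.IsFutureDirected (mfderiv 𝓘(ℝ,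 E4) (𝓡 4) d.flatChart y (E4.basisVector 0)))); let Hf := ( fun (𝓢 : Spacetime.{0} 4) (O : Set 𝓢.carrier) (k : ℕ) (d : FinalStateDecomposition 𝓢 O k) (R₀ : ℝ) => let B := d.background; let t := fun i ↦ (B i).time; let r := fun i ↦ (B i).radius; let Φ := d.flatChart; (∀ τ₂ : ℝ, d.τ₀ < τ₂ → Φ '' {y | d.τ₀ < y.1 0 ∧ y.1 0 < τ₂} ⊆ 𝓢.metric.causalPast 𝓢.timeOrientation (Φ '' (Minkowski.backgroundOn d.flatDomain).timeSlab τ₂)) ∧ (∀ τ' : ℝ, d.τ₀ < τ' → closure (Φ '' {y | τ' ≤ y.1 0 ∧ ∀ i, d.excision i (y.1 0) + 1 ≤ r i y.1}) ⊆ Φ '' {y | τ' ≤ y.1 0}) ∧ (∀ i, ∃ T : ℝ, supCkENorm (Subtype.val '' {x : (B i).domain | T ≤ t i x.1 ∧ R₀ ≤ r i x.1 ∧ ∀ j, j ≠ i → r i x.1 ≤ r j x.1}) 0 (𝓢.deviationExtend (B i) (d.chart i)) ≤ ENNReal.ofReal (1 / (10 * ‖(((d.motion i).1 : E4 ≃L[ℝ]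 E4) : E4 →L[ℝ] E4)‖ ^ 2))) ); let Fc := (fun (𝓢 : Spacetime.{0} 4) (O : Set 𝓢.carrier) (k : ℕ) (d : FinalStateDecomposition 𝓢 O k) (R₀ : ℝ) => let B := d.background; let t := fun i ↦ (B i).time; let r := fun i ↦ (B i).radius; (∀ i (R : ℝ), Filter.Tendsto (fun τ : ℝ ↦ supCkENorm (Subtype.val '' {x : (B i).domain | t i x.1 = τ ∧ R₀ ≤ r i x.1 ∧ r i x.1 ≤ R}) 3 (𝓢.deviationExtend (B i) (d.chart i))) Filter.atTop (nhds 0))); ∀ (X : Type) [TopologicalSpace X] [ChartedSpace E3 X] [IsManifold (𝓡 3) ∞ X] [T2Space X] [SecondCountableTopology X] [ConnectedSpace X], ∀ D ∈ admissibleVacuumData X, (∃ (e : AFEnd X) (M : ℝ), e.IsStronglyAsymptoticallyFlatWith D M 1 2 6 5) → ∀ 𝒟 : VacuumCauchyDevelopment D, 𝒟.IsMaximal → HasCompleteNullInfinity 𝒟.toCauchyDevelopment → ∀ (O₀ : Set 𝒟.carrier) (d₀ : FinalStateDecomposition 𝒟.toSpacetime O₀ 0) (R₀ : ℝ), O₀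 = exteriorOf 𝒟.toCauchyDevelopment d₀.charted → RaysStayInClosure 𝒟.toCauchyDevelopment O₀ → IsFutureOriented d₀ → Hc0 𝒟.toSpacetime O₀ 0 d₀ R₀ → Hf 𝒟.toSpacetime O₀ 0 d₀ R₀ → ∃ (O : Set 𝒟.carrier) (d : FinalStateDecomposition 𝒟.toSpacetime O 0) (R₁ : ℝ), O = exteriorOf 𝒟.toCauchyDevelopment d.charted ∧ RaysStayInClosure 𝒟.toCauchyDevelopment O ∧ Hc0 𝒟.toSpacetime O 0 d R₁ ∧ Hf 𝒟.toSpacetime O 0 d R₁ ∧ Fc 𝒟.toSpacetime O 0 d R₁) → (open Literature.Geometry.Lorentzian in open scoped ContDiff ENNReal in let Hc0 := (fun (𝓢 : Spacetime.{0} 4) (O : Set 𝓢.carrier) (k : ℕ) (d : FinalStateDecomposition 𝓢 O k) (R₀ : ℝ) => let B := d.background; let t := fun i ↦ (B i).time; let r := fun i ↦ (B i).radius; let Ψ := d.chart; (∀ i, 100 * d.mass i ≤ R₀ ∧ 0 < ((d.motion i).1 : E4 ≃L[ℝ] E4) (E4.basisVector 0) 0) ∧ (∀ i (ϱ τ₂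 : ℝ), R₀ ≤ ϱ → d.τ₀ < τ₂ → Ψ i '' {x | d.τ₀ < t i x.1 ∧ t i x.1 < τ₂ ∧ r i x.1 < ϱ} ⊆ 𝓢.metric.causalPast 𝓢.timeOrientation (Ψ i '' (B i).truncTimeSlab ϱ τ₂)) ∧ (∀ i (τ' : ℝ) (ϱ : ℝ → ℝ), Continuous ϱ → d.τ₀ < τ' → let A := Ψ i '' {x | τ' ≤ t i x.1 ∧ r i x.1 ≤ ϱ (t i x.1)}; closure A ∩ O ⊆ A) ∧ (∀ y : d.flatDomain, d.τ₀ < y.1 0 → 𝓢.timeOrientation.IsFutureDirected (mfderiv 𝓘(ℝ, E4) (𝓡 4) d.flatChart y (E4.basisVector 0)))); let Hc := ( fun (𝓢 : Spacetime.{0} 4) (O : Set 𝓢.carrier) (k : ℕ) (d : FinalStateDecomposition 𝓢 O k) (R₀ : ℝ) => let B := d.background; let t := fun i ↦ (B i).time; let r := fun i ↦ (B i).radius; let Ψ := d.chart; (∀ i, Kerr.IsSubextremal (d.mass i) (d.spin i) ∧ 100 * d.mass i ≤ R₀ ∧ 0 < ((d.motion i).1 : E4 ≃L[ℝ] E4)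 (E4.basisVector 0) 0) ∧ (∀ i (ϱ τ₂ : ℝ), R₀ ≤ ϱ → d.τ₀ < τ₂ → Ψ i '' {x | d.τ₀ < t i x.1 ∧ t i x.1 < τ₂ ∧ r i x.1 < ϱ} ⊆ 𝓢.metric.causalPast 𝓢.timeOrientation (Ψ i '' (B i).truncTimeSlab ϱ τ₂)) ∧ (∀ i (τ' : ℝ) (ϱ : ℝ → ℝ), Continuous ϱ → d.τ₀ < τ' → let A := Ψ i '' {x | τ' ≤ t i x.1 ∧ r i x.1 ≤ ϱ (t i x.1)}; closure A ∩ O ⊆ A) ∧ (∀ y : d.flatDomain, d.τ₀ < y.1 0 → 𝓢.timeOrientation.IsFutureDirected (mfderiv 𝓘(ℝ, E4) (𝓡 4) d.flatChart y (E4.basisVector 0))) ); let Hf := ( fun (𝓢 : Spacetime.{0} 4) (O : Set 𝓢.carrier) (k : ℕ) (d : FinalStateDecomposition 𝓢 O k) (R₀ : ℝ) => let B := d.background; let t := fun i ↦ (B i).time; let r := fun i ↦ (B i).radius; let Φ := d.flatChart; (∀ τ₂ : ℝ, d.τ₀ < τ₂ → Φ '' {y | d.τ₀ < y.1 0 ∧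 y.1 0 < τ₂} ⊆ 𝓢.metric.causalPast 𝓢.timeOrientation (Φ '' (Minkowski.backgroundOn d.flatDomain).timeSlab τ₂)) ∧ (∀ τ' : ℝ, d.τ₀ < τ' → closure (Φ '' {y | τ' ≤ y.1 0 ∧ ∀ i, d.excision i (y.1 0) + 1 ≤ r i y.1}) ⊆ Φ '' {y | τ' ≤ y.1 0}) ∧ (∀ i, ∃ T : ℝ, supCkENorm (Subtype.val '' {x : (B i).domain | T ≤ t i x.1 ∧ R₀ ≤ r i x.1 ∧ ∀ j, j ≠ i → r i x.1 ≤ r j x.1}) 0 (𝓢.deviationExtend (B i) (d.chart i)) ≤ ENNReal.ofReal (1 / (10 * ‖(((d.motion i).1 : E4 ≃L[ℝ] E4) : E4 →L[ℝ] E4)‖ ^ 2))) ); let Fc := (fun (𝓢 : Spacetime.{0} 4) (O : Set 𝓢.carrier) (k : ℕ) (d : FinalStateDecomposition 𝓢 O k) (R₀ : ℝ) => let B := d.background; let t := fun i ↦ (B i).time; let r := fun i ↦ (B i).radius; (∀ i (R : ℝ), Filter.Tendsto (fun τ : ℝ ↦ supCkENorm (Subtype.val '' {x : (B i).domain | t i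 x.1 = τ ∧ R₀ ≤ r i x.1 ∧ r i x.1 ≤ R}) 3 (𝓢.deviationExtend (B i) (d.chart i))) Filter.atTop (nhds 0))); ∀ (X : Type) [TopologicalSpace X] [ChartedSpace E3 X] [IsManifold (𝓡 3) ∞ X] [T2Space X] [SecondCountableTopology X] [ConnectedSpace X], ∀ D ∈ admissibleVacuumData X, (∃ (e : AFEnd X) (M : ℝ), e.IsStronglyAsymptoticallyFlatWith D M 1 2 6 5) → ∀ 𝒟 : VacuumCauchyDevelopment D, 𝒟.IsMaximal → HasCompleteNullInfinity 𝒟.toCauchyDevelopment → ∀ (O₁ : Set 𝒟.carrier) (d₁ : FinalStateDecomposition 𝒟.toSpacetime O₁ 0) (R₁ : ℝ), O₁ = exteriorOf 𝒟.toCauchyDevelopment d₁.charted → RaysStayInClosure 𝒟.toCauchyDevelopment O₁ → Hc0 𝒟.toSpacetime O₁ 0 d₁ R₁ → Hf 𝒟.toSpacetime O₁ 0 d₁ R₁ → Fc 𝒟.toSpacetime O₁ 0 d₁ R₁ → (∀ i, Kerr.IsSubextremal (d₁.mass i) (d₁.spin i)) → ∃ (O : Set 𝒟.carrier) (d : FinalStateDecomposition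 𝒟.toSpacetime O 4) (R₂ : ℝ), O = exteriorOf 𝒟.toCauchyDevelopment d.charted ∧ RaysStayInClosure 𝒟.toCauchyDevelopment O ∧ Hc 𝒟.toSpacetime O 4 d R₂ ∧ Hf 𝒟.toSpacetime O 4 d R₂) →
    (open Literature.Geometry.Lorentzian in open scoped ContDiff ENNReal in let Hc0 := (fun (𝓢 : Spacetime.{0} 4) (O : Set 𝓢.carrier) (k : ℕ) (d : FinalStateDecomposition 𝓢 O k) (R₀ : ℝ) => let B := d.background; let t := fun i ↦ (B i).time; let r := fun i ↦ (B i).radius; let Ψ := d.chart; (∀ i, 100 * d.mass i ≤ R₀ ∧ 0 < ((d.motion i).1 : E4 ≃L[ℝ] E4) (E4.basisVector 0) 0) ∧ (∀ i (ϱ τ₂ : ℝ), R₀ ≤ ϱ → d.τ₀ < τ₂ → Ψ i '' {x | d.τ₀ < t i x.1 ∧ t i x.1 < τ₂ ∧ r i x.1 < ϱ} ⊆ 𝓢.metric.causalPast 𝓢.timeOrientation (Ψ i '' (B i).truncTimeSlab ϱ τ₂)) ∧ (∀ i (τ' : ℝ) (ϱ : ℝ → ℝ), Continuous ϱ → d.τ₀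 < τ' → let A := Ψ i '' {x | τ' ≤ t i x.1 ∧ r i x.1 ≤ ϱ (t i x.1)}; closure A ∩ O ⊆ A) ∧ (∀ y : d.flatDomain, d.τ₀ < y.1 0 → 𝓢.timeOrientation.IsFutureDirected (mfderiv 𝓘(ℝ, E4) (𝓡 4) d.flatChart y (E4.basisVector 0)))); let Hc := ( fun (𝓢 : Spacetime.{0} 4) (O : Set 𝓢.carrier) (k : ℕ) (d : FinalStateDecomposition 𝓢 O k) (R₀ : ℝ) => let B := d.background; let t := fun i ↦ (B i).time; let r := fun i ↦ (B i).radius; let Ψ := d.chart; (∀ i, Kerr.IsSubextremal (d.mass i) (d.spin i) ∧ 100 * d.mass i ≤ R₀ ∧ 0 < ((d.motion i).1 : E4 ≃L[ℝ] E4) (E4.basisVector 0) 0) ∧ (∀ i (ϱ τ₂ : ℝ), R₀ ≤ ϱ → d.τ₀ < τ₂ → Ψ i '' {x | d.τ₀ < t i x.1 ∧ t i x.1 < τ₂ ∧ r i x.1 < ϱ} ⊆ 𝓢.metric.causalPast 𝓢.timeOrientation (Ψ i '' (B i).truncTimeSlab ϱ τ₂)) ∧ (∀ i (τ' : ℝ)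 (ϱ : ℝ → ℝ), Continuous ϱ → d.τ₀ < τ' → let A := Ψ i '' {x | τ' ≤ t i x.1 ∧ r i x.1 ≤ ϱ (t i x.1)}; closure A ∩ O ⊆ A) ∧ (∀ y : d.flatDomain, d.τ₀ < y.1 0 → 𝓢.timeOrientation.IsFutureDirected (mfderiv 𝓘(ℝ, E4) (𝓡 4) d.flatChart y (E4.basisVector 0))) ); let Hf := ( fun (𝓢 : Spacetime.{0} 4) (O : Set 𝓢.carrier) (k : ℕ) (d : FinalStateDecomposition 𝓢 O k) (R₀ : ℝ) => let B := d.background; let t := fun i ↦ (B i).time; let r := fun i ↦ (B i).radius; let Φ := d.flatChart; (∀ τ₂ : ℝ, d.τ₀ < τ₂ → Φ '' {y | d.τ₀ < y.1 0 ∧ y.1 0 < τ₂} ⊆ 𝓢.metric.causalPast 𝓢.timeOrientation (Φ '' (Minkowski.backgroundOn d.flatDomain).timeSlab τ₂)) ∧ (∀ τ' : ℝ, d.τ₀ < τ' → closure (Φ '' {y | τ' ≤ y.1 0 ∧ ∀ i, d.excision i (y.1 0) + 1 ≤ r i y.1}) ⊆ Φ '' {y | τ' ≤ y.1 0}) ∧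 (∀ i, ∃ T : ℝ, supCkENorm (Subtype.val '' {x : (B i).domain | T ≤ t i x.1 ∧ R₀ ≤ r i x.1 ∧ ∀ j, j ≠ i → r i x.1 ≤ r j x.1}) 0 (𝓢.deviationExtend (B i) (d.chart i)) ≤ ENNReal.ofReal (1 / (10 * ‖(((d.motion i).1 : E4 ≃L[ℝ] E4) : E4 →L[ℝ] E4)‖ ^ 2))) ); let Fc := (fun (𝓢 : Spacetime.{0} 4) (O : Set 𝓢.carrier) (k : ℕ) (d : FinalStateDecomposition 𝓢 O k) (R₀ : ℝ) => let B := d.background; let t := fun i ↦ (B i).time; let r := fun i ↦ (B i).radius; (∀ i (R : ℝ), Filter.Tendsto (fun τ : ℝ ↦ supCkENorm (Subtype.val '' {x : (B i).domain | t i x.1 = τ ∧ R₀ ≤ r i x.1 ∧ r i x.1 ≤ R}) 3 (𝓢.deviationExtend (B i) (d.chart i))) Filter.atTop (nhds 0))); ∀ (X : Type) [TopologicalSpace X] [ChartedSpace E3 X] [IsManifold (𝓡 3) ∞ X] [T2Space X] [SecondCountableTopology X] [ConnectedSpace X], ∀ D ∈ admissibleVacuumData X, (∃ (e : AFEnd X)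 (M : ℝ), e.IsStronglyAsymptoticallyFlatWith D M 1 2 6 5) → ∀ 𝒟 : VacuumCauchyDevelopment D, 𝒟.IsMaximal → HasCompleteNullInfinity 𝒟.toCauchyDevelopment → ∀ (O₀ : Set 𝒟.carrier) (d₀ : FinalStateDecomposition 𝒟.toSpacetime O₀ 0) (R₀ : ℝ), O₀ = exteriorOf 𝒟.toCauchyDevelopment d₀.charted → RaysStayInClosure 𝒟.toCauchyDevelopment O₀ → IsFutureOriented d₀ → Hc0 𝒟.toSpacetime O₀ 0 d₀ R₀ → Hf 𝒟.toSpacetime O₀ 0 d₀ R₀ → (∀ (O : Set 𝒟.carrier) (d : FinalStateDecomposition 𝒟.toSpacetime O 0) (R₀ : ℝ), O = exteriorOf 𝒟.toCauchyDevelopment d.charted → RaysStayInClosure 𝒟.toCauchyDevelopment O → Hc0 𝒟.toSpacetime O 0 d R₀ → Hf 𝒟.toSpacetime O 0 d R₀ → Fc 𝒟.toSpacetime O 0 d R₀ → ∀ i, Kerr.IsSubextremal (d.mass i) (d.spin i)) → ∃ (O : Set 𝒟.carrier) (d : FinalStateDecomposition 𝒟.toSpacetime O 4) (R₂ : ℝ),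 O = exteriorOf 𝒟.toCauchyDevelopment d.charted ∧ RaysStayInClosure 𝒟.toCauchyDevelopment O ∧ Hc 𝒟.toSpacetime O 4 d R₂ ∧ Hf 𝒟.toSpacetime O 4 d R₂) := by
  intro hG hU; dsimp only
  intro X _ _ _ _ _ _ D hD hclean 𝒟 h𝒟 hscri O₀ d₀ R₀ hO₀ hrays₀ hfo₀ hcore₀ hfar₀ hLab
  -- far derivative gain (label-free): an honest `C⁰` configuration that is `C³`-settled on the far annuli
  obtain ⟨O₁, d₁, R₁, hO₁, hrays₁, hcore₁, hfar₁, hfc₁⟩ :=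
    hG X D hD hclean 𝒟 h𝒟 hscri O₀ d₀ R₀ hO₀ hrays₀ hfo₀ hcore₀ hfar₀
  -- the label hypothesis, read at far-`C³` (the only place labels are read): sub-extremal
  have hsub₁ : ∀ i, Kerr.IsSubextremal (d₁.mass i) (d₁.spin i) := hLab O₁ d₁ R₁ hO₁ hrays₁ hcore₁ hfar₁ hfc₁
  -- red-shift upgrade to an honest fixed-radius `C⁴` configuration, rays clause re-delivered
  exact hU X D hD hclean 𝒟 h𝒟 hscri O₁ d₁ R₁ hO₁ hrays₁ hcore₁ hfar₁ hfc₁ hsub₁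

/-- **The crux from the three split children (kernel-checked glue; the two named items BY NAME).** -/
theorem HonestFixedRadiusSettlingT_of_subs :
    (open Literature.Geometry.Lorentzian in open scoped ContDiff ENNReal in let Hc0 := (fun (𝓢 : Spacetime.{0} 4) (O : Set 𝓢.carrier) (k : ℕ) (d : FinalStateDecomposition 𝓢 O k) (R₀ : ℝ) => let B := d.background; let t := fun i ↦ (B i).time; let r := fun i ↦ (B i).radius; let Ψ := d.chart; (∀ i, 100 * d.mass i ≤ R₀ ∧ 0 < ((d.motion i).1 : E4 ≃L[ℝ] E4) (E4.basisVector 0) 0) ∧ (∀ i (ϱ τ₂ : ℝ), R₀ ≤ ϱ → d.τ₀ < τ₂ → Ψ i '' {x | d.τ₀ < t i x.1 ∧ t i x.1 < τ₂ ∧ r i x.1 < ϱ} ⊆ 𝓢.metric.causalPast 𝓢.timeOrientation (Ψ i '' (B i).truncTimeSlab ϱ τ₂)) ∧ (∀ i (τ' : ℝ) (ϱ : ℝ → ℝ), Continuous ϱ → d.τ₀ < τ' → let A := Ψ i '' {x | τ' ≤ t i x.1 ∧ r i x.1 ≤ ϱ (t i x.1)}; closure A ∩ O ⊆ A) ∧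 (∀ y : d.flatDomain, d.τ₀ < y.1 0 → 𝓢.timeOrientation.IsFutureDirected (mfderiv 𝓘(ℝ, E4) (𝓡 4) d.flatChart y (E4.basisVector 0)))); let Hc := ( fun (𝓢 : Spacetime.{0} 4) (O : Set 𝓢.carrier) (k : ℕ) (d : FinalStateDecomposition 𝓢 O k) (R₀ : ℝ) => let B := d.background; let t := fun i ↦ (B i).time; let r := fun i ↦ (B i).radius; let Ψ := d.chart; (∀ i, Kerr.IsSubextremal (d.mass i) (d.spin i) ∧ 100 * d.mass i ≤ R₀ ∧ 0 < ((d.motion i).1 : E4 ≃L[ℝ] E4) (E4.basisVector 0) 0) ∧ (∀ i (ϱ τ₂ : ℝ), R₀ ≤ ϱ → d.τ₀ < τ₂ → Ψ i '' {x | d.τ₀ < t i x.1 ∧ t i x.1 < τ₂ ∧ r i x.1 < ϱ} ⊆ 𝓢.metric.causalPast 𝓢.timeOrientation (Ψ i '' (B i).truncTimeSlab ϱ τ₂)) ∧ (∀ i (τ' : ℝ) (ϱ : ℝ → ℝ), Continuous ϱ → d.τ₀ < τ' → let A := Ψ i '' {x | τ' ≤ t i x.1 ∧ r i x.1 ≤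 ϱ (t i x.1)}; closure A ∩ O ⊆ A) ∧ (∀ y : d.flatDomain, d.τ₀ < y.1 0 → 𝓢.timeOrientation.IsFutureDirected (mfderiv 𝓘(ℝ, E4) (𝓡 4) d.flatChart y (E4.basisVector 0))) ); let Hf := ( fun (𝓢 : Spacetime.{0} 4) (O : Set 𝓢.carrier) (k : ℕ) (d : FinalStateDecomposition 𝓢 O k) (R₀ : ℝ) => let B := d.background; let t := fun i ↦ (B i).time; let r := fun i ↦ (B i).radius; let Φ := d.flatChart; (∀ τ₂ : ℝ, d.τ₀ < τ₂ → Φ '' {y | d.τ₀ < y.1 0 ∧ y.1 0 < τ₂} ⊆ 𝓢.metric.causalPast 𝓢.timeOrientation (Φ '' (Minkowski.backgroundOn d.flatDomain).timeSlab τ₂)) ∧ (∀ τ' : ℝ, d.τ₀ < τ' → closure (Φ '' {y | τ' ≤ y.1 0 ∧ ∀ i, d.excision i (y.1 0) + 1 ≤ r i y.1}) ⊆ Φ '' {y | τ' ≤ y.1 0}) ∧ (∀ i, ∃ T : ℝ, supCkENorm (Subtype.val '' {x : (B i).domain | T ≤ t i x.1 ∧ R₀ ≤ r i x.1 ∧ ∀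 j, j ≠ i → r i x.1 ≤ r j x.1}) 0 (𝓢.deviationExtend (B i) (d.chart i)) ≤ ENNReal.ofReal (1 / (10 * ‖(((d.motion i).1 : E4 ≃L[ℝ] E4) : E4 →L[ℝ] E4)‖ ^ 2))) ); let Fc := (fun (𝓢 : Spacetime.{0} 4) (O : Set 𝓢.carrier) (k : ℕ) (d : FinalStateDecomposition 𝓢 O k) (R₀ : ℝ) => let B := d.background; let t := fun i ↦ (B i).time; let r := fun i ↦ (B i).radius; (∀ i (R : ℝ), Filter.Tendsto (fun τ : ℝ ↦ supCkENorm (Subtype.val '' {x : (B i).domain | t i x.1 = τ ∧ R₀ ≤ r i x.1 ∧ r i x.1 ≤ R}) 3 (𝓢.deviationExtend (B i) (d.chart i))) Filter.atTop (nhds 0))); ∀ (X : Type) [TopologicalSpace X] [ChartedSpace E3 X] [IsManifold (𝓡 3) ∞ X] [T2Space X] [SecondCountableTopology X] [ConnectedSpace X], InitialDataSet.IsTameChristodoulouGeneric (admissibleVacuumData X) (fun D ↦ (∃ (e : AFEnd X) (M : ℝ), e.IsStronglyAsymptoticallyFlatWith D M 1 2 6 5) ∧ (∃ 𝒟 : VacuumCauchyDevelopment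 D, 𝒟.IsMaximal) ∧ ∀ 𝒟 : VacuumCauchyDevelopment D, 𝒟.IsMaximal → HasCompleteNullInfinity 𝒟.toCauchyDevelopment ∧ (∀ (O : Set 𝒟.carrier) (d : FinalStateDecomposition 𝒟.toSpacetime O 0) (R₀ : ℝ), O = exteriorOf 𝒟.toCauchyDevelopment d.charted → RaysStayInClosure 𝒟.toCauchyDevelopment O → Hc0 𝒟.toSpacetime O 0 d R₀ → Hf 𝒟.toSpacetime O 0 d R₀ → Fc 𝒟.toSpacetime O 0 d R₀ → ∀ i, Kerr.IsSubextremal (d.mass i) (d.spin i)) ∧ (∀ (O : Set 𝒟.carrier) (d : FinalStateDecomposition 𝒟.toSpacetime O 4) (R₀ : ℝ), O = exteriorOf 𝒟.toCauchyDevelopment d.charted → Hc 𝒟.toSpacetime O 4 d R₀ → Hf 𝒟.toSpacetime O 4 d R₀ → (∀ i j : Fin d.N, i ≠ j → ((d.motion i).1 : E4 ≃L[ℝ] E4) (E4.basisVector 0) ≠ ((d.motion j).1 : E4 ≃L[ℝ] E4) (E4.basisVector 0)))) 1) → Theses.GlobalAttraction.CensoredFixedRadiusSettle → (open Literature.Geometry.Lorentzian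 in open scoped ContDiff ENNReal in let Hc0 := (fun (𝓢 : Spacetime.{0} 4) (O : Set 𝓢.carrier) (k : ℕ) (d : FinalStateDecomposition 𝓢 O k) (R₀ : ℝ) => let B := d.background; let t := fun i ↦ (B i).time; let r := fun i ↦ (B i).radius; let Ψ := d.chart; (∀ i, 100 * d.mass i ≤ R₀ ∧ 0 < ((d.motion i).1 : E4 ≃L[ℝ] E4) (E4.basisVector 0) 0) ∧ (∀ i (ϱ τ₂ : ℝ), R₀ ≤ ϱ → d.τ₀ < τ₂ → Ψ i '' {x | d.τ₀ < t i x.1 ∧ t i x.1 < τ₂ ∧ r i x.1 < ϱ} ⊆ 𝓢.metric.causalPast 𝓢.timeOrientation (Ψ i '' (B i).truncTimeSlab ϱ τ₂)) ∧ (∀ i (τ' : ℝ) (ϱ : ℝ → ℝ), Continuous ϱ → d.τ₀ < τ' → let A := Ψ i '' {x | τ' ≤ t i x.1 ∧ r i x.1 ≤ ϱ (t i x.1)}; closure A ∩ O ⊆ A) ∧ (∀ y : d.flatDomain, d.τ₀ < y.1 0 → 𝓢.timeOrientation.IsFutureDirected (mfderiv 𝓘(ℝ, E4) (𝓡 4)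 d.flatChart y (E4.basisVector 0)))); let Hc := ( fun (𝓢 : Spacetime.{0} 4) (O : Set 𝓢.carrier) (k : ℕ) (d : FinalStateDecomposition 𝓢 O k) (R₀ : ℝ) => let B := d.background; let t := fun i ↦ (B i).time; let r := fun i ↦ (B i).radius; let Ψ := d.chart; (∀ i, Kerr.IsSubextremal (d.mass i) (d.spin i) ∧ 100 * d.mass i ≤ R₀ ∧ 0 < ((d.motion i).1 : E4 ≃L[ℝ] E4) (E4.basisVector 0) 0) ∧ (∀ i (ϱ τ₂ : ℝ), R₀ ≤ ϱ → d.τ₀ < τ₂ → Ψ i '' {x | d.τ₀ < t i x.1 ∧ t i x.1 < τ₂ ∧ r i x.1 < ϱ} ⊆ 𝓢.metric.causalPast 𝓢.timeOrientation (Ψ i '' (B i).truncTimeSlab ϱ τ₂)) ∧ (∀ i (τ' : ℝ) (ϱ : ℝ → ℝ), Continuous ϱ → d.τ₀ < τ' → let A := Ψ i '' {x | τ' ≤ t i x.1 ∧ r i x.1 ≤ ϱ (t i x.1)}; closure A ∩ O ⊆ A) ∧ (∀ y : d.flatDomain, d.τ₀ < y.1 0 → 𝓢.timeOrientation.IsFutureDirected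 (mfderiv 𝓘(ℝ, E4) (𝓡 4) d.flatChart y (E4.basisVector 0))) ); let Hf := ( fun (𝓢 : Spacetime.{0} 4) (O : Set 𝓢.carrier) (k : ℕ) (d : FinalStateDecomposition 𝓢 O k) (R₀ : ℝ) => let B := d.background; let t := fun i ↦ (B i).time; let r := fun i ↦ (B i).radius; let Φ := d.flatChart; (∀ τ₂ : ℝ, d.τ₀ < τ₂ → Φ '' {y | d.τ₀ < y.1 0 ∧ y.1 0 < τ₂} ⊆ 𝓢.metric.causalPast 𝓢.timeOrientation (Φ '' (Minkowski.backgroundOn d.flatDomain).timeSlab τ₂)) ∧ (∀ τ' : ℝ, d.τ₀ < τ' → closure (Φ '' {y | τ' ≤ y.1 0 ∧ ∀ i, d.excision i (y.1 0) + 1 ≤ r i y.1}) ⊆ Φ '' {y | τ' ≤ y.1 0}) ∧ (∀ i, ∃ T : ℝ, supCkENorm (Subtype.val '' {x : (B i).domain | T ≤ t i x.1 ∧ R₀ ≤ r i x.1 ∧ ∀ j, j ≠ i → r i x.1 ≤ r j x.1}) 0 (𝓢.deviationExtend (B i) (d.chart i)) ≤ ENNReal.ofReal (1 / (10 * ‖(((d.motion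 i).1 : E4 ≃L[ℝ] E4) : E4 →L[ℝ] E4)‖ ^ 2))) ); let Fc := (fun (𝓢 : Spacetime.{0} 4) (O : Set 𝓢.carrier) (k : ℕ) (d : FinalStateDecomposition 𝓢 O k) (R₀ : ℝ) => let B := d.background; let t := fun i ↦ (B i).time; let r := fun i ↦ (B i).radius; (∀ i (R : ℝ), Filter.Tendsto (fun τ : ℝ ↦ supCkENorm (Subtype.val '' {x : (B i).domain | t i x.1 = τ ∧ R₀ ≤ r i x.1 ∧ r i x.1 ≤ R}) 3 (𝓢.deviationExtend (B i) (d.chart i))) Filter.atTop (nhds 0))); ∀ (X : Type) [TopologicalSpace X] [ChartedSpace E3 X] [IsManifold (𝓡 3) ∞ X] [T2Space X] [SecondCountableTopology X] [ConnectedSpace X], ∀ D ∈ admissibleVacuumData X, (∃ (e : AFEnd X) (M : ℝ), e.IsStronglyAsymptoticallyFlatWith D M 1 2 6 5) → ∀ 𝒟 : VacuumCauchyDevelopment D, 𝒟.IsMaximal → HasCompleteNullInfinity 𝒟.toCauchyDevelopment → ∀ (O₀ : Set 𝒟.carrier) (d₀ : FinalStateDecomposition 𝒟.toSpacetime O₀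 0) (R₀ : ℝ), O₀ = exteriorOf 𝒟.toCauchyDevelopment d₀.charted → RaysStayInClosure 𝒟.toCauchyDevelopment O₀ → IsFutureOriented d₀ → Hc0 𝒟.toSpacetime O₀ 0 d₀ R₀ → Hf 𝒟.toSpacetime O₀ 0 d₀ R₀ → (∀ (O : Set 𝒟.carrier) (d : FinalStateDecomposition 𝒟.toSpacetime O 0) (R₀ : ℝ), O = exteriorOf 𝒟.toCauchyDevelopment d.charted → RaysStayInClosure 𝒟.toCauchyDevelopment O → Hc0 𝒟.toSpacetime O 0 d R₀ → Hf 𝒟.toSpacetime O 0 d R₀ → Fc 𝒟.toSpacetime O 0 d R₀ → ∀ i, Kerr.IsSubextremal (d.mass i) (d.spin i)) → ∃ (O : Set 𝒟.carrier) (d : FinalStateDecomposition 𝒟.toSpacetime O 4) (R₂ : ℝ), O = exteriorOf 𝒟.toCauchyDevelopment d.charted ∧ RaysStayInClosure 𝒟.toCauchyDevelopment O ∧ Hc 𝒟.toSpacetime O 4 d R₂ ∧ Hf 𝒟.toSpacetime O 4 d R₂) →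
    Theses.StarvedNecks.HonestFixedRadiusSettlingT := by
  intro h₁ hA hU X _ _ _ _ _ _
  refine mono ?_ (h₁ X)
  rintro D hD ⟨hclean, hex, hall⟩
  refine ⟨hex, fun 𝒟 h𝒟 ↦ ?_⟩
  obtain ⟨hscri, hLab, hdvLab⟩ := hall 𝒟 h𝒟
  -- attraction (item 17684): an honest fixed-radius `C⁰` configuration of this censored MGHD
  obtain ⟨O₀, d₀, R₀, hO₀, hrays₀, hfo₀, hcore₀, hfar₀⟩ := hA X D hD 𝒟 h𝒟 hscri
  -- labelled upgrade: far gain, the generic THIRD-LAW clause read at far-`C³`, red-shift — an honest `C⁴` configuration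
  obtain ⟨O, d, R₂, hO, hrays, hcore, hfar⟩ :=
    hU X D hD hclean 𝒟 h𝒟 hscri O₀ d₀ R₀ hO₀ hrays₀ hfo₀ hcore₀ hfar₀ hLab
  -- the generic RECESSION clause, read at `C⁴` (T's own format): pairwise distinct four-velocities
  exact ⟨hscri, O, d, R₂, hO, hrays, hcore, hfar, hdvLab O d R₂ hO hcore hfar⟩

/-- **The crux BY NAME from the four stubs.**  Pointwise on the admissible class: far-clean + censored-with-labels ⟹ `P_T`
(17684 gives an honest `C⁰` configuration of each MGHD; the label-free far gain makes it `C³` on the far annuli; the far-`C³`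
third-law clause makes its labels sub-extremal; the red-shift upgrade makes it `C⁴`-honest with the rays clause re-delivered;
the `C⁴` recession clause makes it non-comoving); `mono` transfers tame genericity.  No S/E/F/17673 tail. -/
theorem HonestFixedRadiusSettlingT_of : Theses.StarvedNecks.HonestFixedRadiusSettlingT :=
  HonestFixedRadiusSettlingT_of_subs stub_genericCensoredLabelsFar stub_censoredFixedRadiusSettle
    (honestLabelledUpgrade_of_gain_redshift stub_farDerivativeGain stub_subextremalRedShiftUpgrade)

end Summit.FinalStateConjecture.FinalStateConjecture.Cruxes.HonestFixedRadiusSettlingT.FarLabelCut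

end
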